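import Literature.MathematicalPhysics.QuantumManyBody.PeriodicBoseGas
import HarnessLib

/-!
# Fournais 2020, Theorem 1.2: reduction to the Fock-space lower bound (Theorem 3.1)

Topic `Literature/MathematicalPhysics/QuantumManyBody`, sibling of `PeriodicBoseGas.lean`
(provefact `Literature.MathematicalPhysics.QuantumManyBody.BoseGas.Fournais2020_condensation`). This file records the top layer of the
proof of [Fournais2020, Thm. 1.2] (`Fournais2020_condensation`), exactly as printed on pp. 3 and
13–14 of the source, and proves the two reductions that are pure algebra:

* `Fournais2020_thm31` — [Fournais2020, Thm. 3.1 (3.1)–(3.2)], the lower bound on the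
  "grand-canonical" Hamiltonian
  `H_{ρ_μ,N} = ∑ᵢ (-Δᵢ - 2π² L⁻² Qᵢ) + ∑_{i<j} v^per(xᵢ - xⱼ) - 8π a ρ_μ N ≥
   -4π ρ_μ² a L³ (1 + C₁ (ρ_μ a³)^{1/2})`, restricted to the `N`-particle sector and to periodic
  `C¹` states (named fact: its proof is the body of the paper — the sliding localisation of
  Lemmas 3.2–3.3 and (3.13)–(3.15) onto boxes of side `ℓ = K⁻¹ (ρ_μ a)^{-1/2}` (2.1), and the
  second-quantised small-box bound Thm. 2.1 = [Brietzke–Fournais–Solovej 2020, Thm. 6.1] — none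
  of whose Fock-space machinery exists in Mathlib or Literature yet).
* `Fournais2020_lowerBound_Htilde` — the lower bound (1.12) on
  `H̃ = ∑ⱼ (-Δⱼ - 2π² L⁻² Q_{Ω,j}) + ∑_{j<k} v^per` (1.11):
  `⟨Ψ, H̃ Ψ⟩ ≥ 4π a ρ N - C a ρ (ρa³)^{1/2} N` on the boxes (1.7). **Sign.** The display (1.12)
  is printed with `+ C₀ aρ(ρa³)^{1/2} N`; the paper derives (1.12) from Thm. 3.1 through (3.3),
  `⟨Ψ, H̃Ψ⟩ ≥ 4πaρ²L³ - 4πa(ρ-ρ_μ)²L³ - 4πρ_μ²aL³C₁(ρ_μa³)^{1/2}` at `ρ_μ = ρ`, which is the bound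
  with `- 4πC₁ aρ(ρa³)^{1/2}N`; we vendor what is proved (the `+` is a misprint, and is not
  needed: any error `o(aρN · L⁻²…)` of this size gives Thm. 1.2).
* `Fournais2020_lowerBound_Htilde_of_thm31` — proof of (1.12) from Thm. 3.1 [(3.3), p. 14].
* `Fournais2020_condensation_of_lowerBound_Htilde` — proof of Thm. 1.2 from (1.12) [Remark
  after Thm. 1.2, (1.10)–(1.12), p. 3]: `H = H̃ + 2π²L⁻² n₊` and `n₊ = N - n₀` (1.4), so (1.8) and
  (1.12) give `2π²L⁻² ⟨n₊⟩ ≤ (C₀ + C) aρ(ρa³)^{1/2-ε} N` for `ρa³ ≤ 1`, i.e. (1.9) with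
  constant `(C₀ + C)/(2π²)`.

Hence `Fournais2020_condensation` follows from `Fournais2020_thm31`
(`Fournais2020_condensation_of_thm31`); discharging Thm. 3.1 itself needs the bosonic Fock
space over `L²(Λ)`, second quantisation and the Bogoliubov-type estimates of §2 (future work,
tracked in the provefact notes).

## Rendering

All expectations are the `ℝ≥0∞`-valued quadratic forms of `PeriodicBoseGas.lean`:
`⟨Ψ, HΨ⟩ = periodicEnergy v Ψ`, `⟨Ψ, n₀Ψ⟩ = condensateOccupation N L Ψ` and
`⟨Ψ, n₊Ψ⟩ = N - ⟨Ψ, n₀Ψ⟩`; inequalities with negative terms are written additively (every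
term moved to the side where it is added), `a := (scatteringLength v).toReal`, Assumption 1.1
as in `Fournais2020_condensation` (finite range, `∫ v(|x|)dx < ∞`, `a > 0`), constants
quantified `∃` after `v` and the fixed parameters, "for `ρ_μ a³` sufficiently small" as
`ρ_μ a³ ≤ c`. In Thm. 3.1 the side `L` of the torus is a free parameter subject to the
standing requirement `2ℓ < L` of its proof ("it is important that `R < ℓ < L/2`", p. 14;
Lemmas 3.2, 3.3 assume `2ℓ < L`), with `ℓ = (K √(ρ_μ a))⁻¹` and `K` the (large) constant of
Thm. 2.1, quantified existentially; `R < ℓ` is part of "`ρ_μ a³` small".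

## References

* [Fournais2020] S. Fournais, *Length scales for BEC in the dilute Bose gas*, arXiv:2011.00309,
  in: Partial Differential Equations, Spectral Theory, and Mathematical Physics (Ari Laptev
  anniversary volume), EMS Ser. Congr. Rep. 18 (2021), doi:10.4171/ecr/18-1/7: Thm. 1.2
  (1.7)–(1.9), Remark (1.10)–(1.12) p. 3, Thm. 3.1 (3.1)–(3.3) pp. 13–14, (2.1).
* [BFS2020] B. Brietzke, S. Fournais, J. P. Solovej, *A simple 2nd order lower bound to the
  energy of dilute Bose gases*, Comm. Math. Phys. 376 (2020) — Thm. 6.1 (= Fournais Thm. 2.1),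
  Lemma 5.7 (= Fournais Lemma 3.3).
-/

noncomputable section

open MeasureTheory
open scoped ENNReal NNReal

namespace Literature.MathematicalPhysics.QuantumManyBody.BoseGas

/-! ### Named facts: the lower layers of the proof -/

/-- **Fournais 2020, Theorem 3.1** (lower bound for the background Hamiltonian on the torus),
on the `N`-particle sector. Let `v` satisfy Assumption 1.1 with scattering length `a`. There are
`K, C₁, c > 0` such that for every `ρ_μ > 0` with `ρ_μ a³ ≤ c`, every torus `ℝ³/Lℤ³` with
`2ℓ < L`, `ℓ = (K√(ρ_μ a))⁻¹` (2.1), every `N` and every normalised periodic `N`-body state `Ψ`,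
`⟨Ψ, H_{ρ_μ,N} Ψ⟩ ≥ -4π ρ_μ² a L³ (1 + C₁ (ρ_μ a³)^{1/2})` (3.2), where
`H_{ρ_μ,N} = ∑ᵢ (-Δᵢ - 2π²L⁻² Qᵢ) + ∑_{i<j} v^per(xᵢ - xⱼ) - 8π a ρ_μ N` (3.1) and
`∑ᵢ Qᵢ = n₊ = N - n₀`; written additively:
`2π²L⁻² N + 8πaρ_μN ≤ ⟨Ψ,HΨ⟩ + 2π²L⁻² ⟨Ψ,n₀Ψ⟩ + 4πρ_μ²aL³(1 + C₁(ρ_μa³)^{1/2})`.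
[cite: Fournais2020, Thm. 3.1 (3.1)–(3.2)] -/
def Fournais2020_thm31 : Prop :=
  ∀ (v : ℝ → ℝ≥0∞), IsRepulsiveFiniteRange v → (∫⁻ x : Space, v ‖x‖) ≠ ⊤ →
    0 < scatteringLength v →
  ∃ K C₁ c : ℝ, 0 < K ∧ 0 < C₁ ∧ 0 < c ∧
    ∀ (ρμ : ℝ) (N : ℕ) (L : ℝ), 0 < ρμ → 0 < L →
      let a := (scatteringLength v).toReal
      ρμ * a ^ 3 ≤ c →
      2 * (K * Real.sqrt (ρμ * a))⁻¹ < L →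
      ∀ Ψ : PeriodicTrialState N L,
        ENNReal.ofReal (2 * Real.pi ^ 2 / L ^ 2 * N + 8 * Real.pi * a * ρμ * N) ≤
          periodicEnergy v Ψ +
            ENNReal.ofReal (2 * Real.pi ^ 2 / L ^ 2) * condensateOccupation N L Ψ.ψ +
            ENNReal.ofReal
              (4 * Real.pi * ρμ ^ 2 * a * L ^ 3 * (1 + C₁ * (ρμ * a ^ 3) ^ (1 / 2 : ℝ)))

/-- **Fournais 2020, (1.12)** (lower bound for `H̃`, with the sign that (3.3) proves). Let `v`
satisfy Assumption 1.1 with scattering length `a`, and fix `C_L, δ > 0`. There are `C, c > 0`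
such that on every periodic box tied to the density `ρ = N/L³` by `L = C_L(ρa³)^{-δ}(ρa)^{-1/2}`
(1.7) with `ρa³ ≤ c`, every normalised periodic `N`-body state satisfies
`⟨Ψ, H̃Ψ⟩ ≥ 4πaρN - C aρ(ρa³)^{1/2} N`, `H̃ = ∑ⱼ(-Δⱼ - 2π²L⁻²Q_{Ω,j}) + ∑_{j<k} v^per(xⱼ - x_k)`
(1.11), i.e. additively (`∑ⱼ Q_{Ω,j} = N - n₀`):
`4πaρN + 2π²L⁻²N ≤ ⟨Ψ,HΨ⟩ + 2π²L⁻²⟨Ψ,n₀Ψ⟩ + C aρ(ρa³)^{1/2}N`. (The display (1.12) prints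
`+ C₀aρ(ρa³)^{1/2}N`; the derivation (3.3) at `ρ_μ = ρ` gives `- 4πC₁ aρ(ρa³)^{1/2}N`, vendored
here.) [cite: Fournais2020, (1.11)–(1.12) and (3.3)] -/
def Fournais2020_lowerBound_Htilde : Prop :=
  ∀ (v : ℝ → ℝ≥0∞), IsRepulsiveFiniteRange v → (∫⁻ x : Space, v ‖x‖) ≠ ⊤ →
    0 < scatteringLength v →
  ∀ (C_L δ : ℝ), 0 < C_L → 0 < δ →
  ∃ C c : ℝ, 0 < C ∧ 0 < c ∧
    ∀ (N : ℕ) (L : ℝ), 0 < N → 0 < L →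
      let a := (scatteringLength v).toReal
      let ρ := (N : ℝ) / L ^ 3
      ρ * a ^ 3 ≤ c →
      L = C_L * (ρ * a ^ 3) ^ (-δ) / Real.sqrt (ρ * a) →
      ∀ Ψ : PeriodicTrialState N L,
        ENNReal.ofReal (4 * Real.pi * a * ρ * N) + ENNReal.ofReal (2 * Real.pi ^ 2 / L ^ 2 * N) ≤
          periodicEnergy v Ψ +
            ENNReal.ofReal (2 * Real.pi ^ 2 / L ^ 2) * condensateOccupation N L Ψ.ψ +
            ENNReal.ofReal (C * a * ρ * (ρ * a ^ 3) ^ (1 / 2 : ℝ) * N)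

/-! ### The reductions -/

/-- Under Assumption 1.1 as rendered (`∫ v(|x|) dx < ∞`, `0 < a`), the scattering length is a
positive real number. [cite: Fournais2020, Assumption 1.1] -/
theorem scatteringLength_toReal_pos {v : ℝ → ℝ≥0∞} (hint : (∫⁻ x : Space, v ‖x‖) ≠ ⊤)
    (ha : 0 < scatteringLength v) : 0 < (scatteringLength v).toReal := by
  refine ENNReal.toReal_pos ha.ne' (scatteringLength_ne_top ?_)
  rw [lintegral_const_mul' _ _ (ENNReal.inv_ne_top.2 two_ne_zero)]
  exact ENNReal.mul_ne_top (ENNReal.inv_ne_top.2 two_ne_zero) hint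

/-- **(1.12) from Theorem 3.1** [Fournais2020, p. 14, (3.3)]: at `ρ_μ = ρ = N/L³` one has
`4πρ_μ²aL³ = 4πaρN` and `8πaρ_μN - 4πaρN = 4πaρN`, and the box (1.7) satisfies `2ℓ < L` as soon
as `(ρa³)^δ < C_L K/2`. [cite: Fournais2020, (3.3)] -/
theorem Fournais2020_lowerBound_Htilde_of_thm31 (h : Fournais2020_thm31) :
    Fournais2020_lowerBound_Htilde := by
  intro v hv hint ha C_L δ hCL hδ
  obtain ⟨K, C₁, c, hK, hC₁, hc, H⟩ := h v hv hint ha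
  refine ⟨4 * Real.pi * C₁, min c ((C_L * K / 4) ^ δ⁻¹), by positivity, lt_min hc (by positivity),
    ?_⟩
  intro N L hN hL a ρ hρc hLeq Ψ
  have ha0 : 0 < a := scatteringLength_toReal_pos hint ha
  have hN0 : (0 : ℝ) < N := Nat.cast_pos.2 hN
  have hρ : 0 < ρ := by positivity
  have hx : 0 < ρ * a ^ 3 := by positivity
  -- the box (1.7) is longer than `2ℓ`
  have hxδ : (ρ * a ^ 3) ^ δ ≤ C_L * K / 4 :=
    calc (ρ * a ^ 3) ^ δ ≤ (min c ((C_L * K / 4) ^ δ⁻¹)) ^ δ := Real.rpow_le_rpow hx.le hρc hδ.le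
      _ ≤ ((C_L * K / 4) ^ δ⁻¹) ^ δ :=
          Real.rpow_le_rpow (le_min hc.le (by positivity)) (min_le_right _ _) hδ.le
      _ = C_L * K / 4 := Real.rpow_inv_rpow (by positivity) hδ.ne'
  have hℓ : 2 * (K * Real.sqrt (ρ * a))⁻¹ < L := by
    have hsq : 0 < Real.sqrt (ρ * a) := Real.sqrt_pos.2 (by positivity)
    have h2K : 2 / K < C_L * (ρ * a ^ 3) ^ (-δ) := by
      rw [Real.rpow_neg hx.le]
      calc 2 / K < 4 / K := by gcongr; norm_num
        _ = C_L * (C_L * K / 4)⁻¹ := by field_simp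
        _ ≤ C_L * ((ρ * a ^ 3) ^ δ)⁻¹ := by gcongr
    calc 2 * (K * Real.sqrt (ρ * a))⁻¹ = 2 / K * (Real.sqrt (ρ * a))⁻¹ := by
          rw [mul_inv, div_eq_mul_inv, mul_assoc]
      _ < C_L * (ρ * a ^ 3) ^ (-δ) * (Real.sqrt (ρ * a))⁻¹ := mul_lt_mul_of_pos_right h2K (inv_pos.2 hsq)
      _ = L := by rw [hLeq, div_eq_mul_inv]
  have key := H ρ N L hρ hL (hρc.trans (min_le_left _ _)) hℓ Ψ
  -- algebra (3.3) at `ρ_μ = ρ`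
  have hρL : ρ * L ^ 3 = N := by
    show (N : ℝ) / L ^ 3 * L ^ 3 = N
    field_simp
  set s : ℝ := (ρ * a ^ 3) ^ (1 / 2 : ℝ) with hs
  have hs0 : 0 ≤ s := Real.rpow_nonneg hx.le _
  have hsplit : 4 * Real.pi * ρ ^ 2 * a * L ^ 3 * (1 + C₁ * s) =
      4 * Real.pi * C₁ * a * ρ * s * N + 4 * Real.pi * a * ρ * N := by
    have : 4 * Real.pi * ρ ^ 2 * a * L ^ 3 * (1 + C₁ * s) =
        4 * Real.pi * a * (ρ * L ^ 3) * ρ * (1 + C₁ * s) := by ring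
    rw [this, hρL]; ring
  refine (ENNReal.add_le_add_iff_right
    (ENNReal.ofReal_ne_top : ENNReal.ofReal (4 * Real.pi * a * ρ * N) ≠ ⊤)).1 ?_
  calc ENNReal.ofReal (4 * Real.pi * a * ρ * N) + ENNReal.ofReal (2 * Real.pi ^ 2 / L ^ 2 * N) +
        ENNReal.ofReal (4 * Real.pi * a * ρ * N)
      = ENNReal.ofReal (2 * Real.pi ^ 2 / L ^ 2 * N + 8 * Real.pi * a * ρ * N) := by
        rw [← ENNReal.ofReal_add (by positivity) (by positivity),
          ← ENNReal.ofReal_add (by positivity) (by positivity)]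
        congr 1; ring
    _ ≤ periodicEnergy v Ψ +
          ENNReal.ofReal (2 * Real.pi ^ 2 / L ^ 2) * condensateOccupation N L Ψ.ψ +
          ENNReal.ofReal (4 * Real.pi * ρ ^ 2 * a * L ^ 3 * (1 + C₁ * s)) := key
    _ = periodicEnergy v Ψ +
          ENNReal.ofReal (2 * Real.pi ^ 2 / L ^ 2) * condensateOccupation N L Ψ.ψ +
          ENNReal.ofReal (4 * Real.pi * C₁ * a * ρ * s * N) +
          ENNReal.ofReal (4 * Real.pi * a * ρ * N) := by
        rw [hsplit, ENNReal.ofReal_add (by positivity) (by positivity)]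
        simp only [add_assoc]

/-- **Theorem 1.2 from (1.12)** [Fournais2020, Remark after Thm. 1.2, (1.10)–(1.12)]: since
`H = H̃ + 2π²L⁻² n₊` (1.10)–(1.11) and `n₊ = N - n₀`, the energy assumption (1.8) and (1.12) give
`2π²L⁻² ⟨Ψ,n₊Ψ⟩ ≤ C₀aρ(ρa³)^{1/2-ε}N + Caρ(ρa³)^{1/2}N ≤ (C₀ + C) aρ(ρa³)^{1/2-ε} N` for
`ρa³ ≤ 1`, which is (1.9) with constant `(C₀ + C)/(2π²)`. [cite: Fournais2020, Thm. 1.2 and (1.10)–(1.12)] -/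
theorem Fournais2020_condensation_of_lowerBound_Htilde (h : Fournais2020_lowerBound_Htilde) :
    Fournais2020_condensation := by
  intro v hv hint ha C_L δ ε C₀ hCL hδ hε0 hε hC₀
  obtain ⟨C, c, hC, hc, H⟩ := h v hv hint ha C_L δ hCL hδ
  refine ⟨(C₀ + C) / (2 * Real.pi ^ 2), min c 1, by positivity, lt_min hc one_pos, ?_⟩
  intro N L hN hL a ρ hρc hLeq Ψ hE
  have ha0 : 0 < a := scatteringLength_toReal_pos hint ha
  have hN0 : (0 : ℝ) < N := Nat.cast_pos.2 hN
  have hρ : 0 < ρ := by positivity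
  have hx : 0 < ρ * a ^ 3 := by positivity
  have hx1 : ρ * a ^ 3 ≤ 1 := hρc.trans (min_le_right _ _)
  have key := H N L hN hL (hρc.trans (min_le_left _ _)) hLeq Ψ
  set g : ℝ := 2 * Real.pi ^ 2 / L ^ 2 with hg
  have hg0 : 0 < g := by positivity
  set s : ℝ := (ρ * a ^ 3) ^ (1 / 2 : ℝ) with hs
  set t : ℝ := (ρ * a ^ 3) ^ (1 / 2 - ε) with ht
  have hs0 : 0 ≤ s := Real.rpow_nonneg hx.le _
  have ht0 : 0 ≤ t := Real.rpow_nonneg hx.le _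
  have hst : s ≤ t := Real.rpow_le_rpow_of_exponent_ge hx hx1 (by linarith)
  set A : ℝ := 4 * Real.pi * a * ρ * N with hA
  set B : ℝ := C₀ * a * ρ * t * N with hB
  set n₀ := condensateOccupation N L Ψ.ψ
  -- cancel the leading term `4πaρN`
  have h1 : ENNReal.ofReal g * N ≤ ENNReal.ofReal g * n₀ + ENNReal.ofReal (B + C * a * ρ * t * N) := by
    refine (ENNReal.add_le_add_iff_left (ENNReal.ofReal_ne_top : ENNReal.ofReal A ≠ ⊤)).1 ?_
    calc ENNReal.ofReal A + ENNReal.ofReal g * N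
        = ENNReal.ofReal A + ENNReal.ofReal (g * N) := by
          rw [ENNReal.ofReal_mul hg0.le, ENNReal.ofReal_natCast]
      _ ≤ periodicEnergy v Ψ + ENNReal.ofReal g * n₀ + ENNReal.ofReal (C * a * ρ * s * N) := key
      _ ≤ ENNReal.ofReal (A + B) + ENNReal.ofReal g * n₀ + ENNReal.ofReal (C * a * ρ * t * N) := by
          gcongr
      _ = ENNReal.ofReal A + (ENNReal.ofReal g * n₀ + ENNReal.ofReal (B + C * a * ρ * t * N)) := by
          rw [ENNReal.ofReal_add (by positivity) (by positivity),
            ENNReal.ofReal_add (by positivity) (by positivity)]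
          ac_rfl
  -- divide by the gap `2π²/L²`
  have h2 : ENNReal.ofReal g * N ≤ ENNReal.ofReal g *
      (n₀ + ENNReal.ofReal ((C₀ + C) / (2 * Real.pi ^ 2) * ρ * a * L ^ 2 * t * N)) := by
    calc ENNReal.ofReal g * N ≤ ENNReal.ofReal g * n₀ + ENNReal.ofReal (B + C * a * ρ * t * N) := h1
      _ = ENNReal.ofReal g *
          (n₀ + ENNReal.ofReal ((C₀ + C) / (2 * Real.pi ^ 2) * ρ * a * L ^ 2 * t * N)) := by
          rw [mul_add, ← ENNReal.ofReal_mul hg0.le]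
          congr 2
          rw [hB, hg]
          field_simp
  exact (ENNReal.mul_le_mul_iff_right (ENNReal.ofReal_pos.2 hg0).ne' ENNReal.ofReal_ne_top).1 h2

/-- **Theorem 1.2 from Theorem 3.1**: the complete printed reduction of [Fournais2020], Thm. 1.2
⇐ (1.12) ⇐ Thm. 3.1. [cite: Fournais2020, Thm. 1.2, (1.10)–(1.12), Thm. 3.1, (3.3)] -/
theorem Fournais2020_condensation_of_thm31 (h : Fournais2020_thm31) : Fournais2020_condensation :=
  Fournais2020_condensation_of_lowerBound_Htilde (Fournais2020_lowerBound_Htilde_of_thm31 h)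

end Literature.MathematicalPhysics.QuantumManyBody.BoseGas

end
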